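import Summits.CriticalPhenomena.Ising3D.Control2DOpeTwoSided
import Mathlib.Analysis.SpecialFunctions.Pow.Real
import Mathlib.Analysis.Complex.ExponentialBounds
import Mathlib.Topology.Algebra.InfiniteSum.Real
import Mathlib.Tactic.Linarith
import Mathlib.Tactic.Positivity
import HarnessLib

/-!
# The 2D Ising blind control: the `ε` OPE datum two-sided (kind `ope2eps`) — what the certificates assert
(cell `pub-ising3x`, seat controls-1 gen 13; `SCOPE.md` §4 `### controls-1 v14` ADDENDUM 1 / `v15`, round RB-6)

HONEST FRAMING: lottery ticket; floor = tightest certified 3D Ising CFT bounds; no exact-solution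
claim without a proof. CONTROL-ONLY: the two-dimensional axiom set `A2D′` (de la Fuente,
arXiv:1904.09801 §2: the `ℤ₂`-even scalars of `σ×σ` lie in the `ε` box `[e₁, e₂]` or at `Δ ≥ G`, the
stress tensor plus a spin-2 gap `δ`, unitarity) is NOT the three-dimensional floor's axiom set.

`Control2DOpeTwoSided.lean` (gen 12) types the kind-`ope2` pair (two-sided total `(2,2)` coefficient,
hence two-sided `c`). RB-6's stretch (R16) added the certificate kind `ope2eps` (format
`deriv-functional-2d/4`, readers `verify_A2d.py 2.5.x` / `verify_B2d.py 2.4.x`): two-sided bounds on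
the WEIGHTED IN-BOX SCALAR CONTENT `W := ∑_{ℓ = 0, Δ_i ∈ [e₁,e₂]} p_i 2^{-Δ_i}` of an `A2D′` datum, with
the lane's certified `ε` box as input. Obligations of a functional `φ` acting termwise on the sum rule
`φ[F_𝟙] + ∑ p_i φ[F_i] = 0`: on every `ε` cell (I″) `φ[F_𝟙] + P̃ · 2^Δ φ[F_{Δ,0}] > 0` and the SIGN of
`φ[F_{Δ,0}]` (upper: `> 0`; lower: `< 0`, certified cellwise, hence with a uniform margin), plus
`φ ≥ 0` on every other block `A2D′` allows (scalars `≥ G`, the `(2,2)` point, spin 2 `≥ 2 + δ`, even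
`ℓ ≥ 4` with `Δ ≥ ℓ`). THEOREM: upper ⇒ `W < P̃`; lower ⇒ `P̃ < W`. Since `2^{-e₂} ≤ 2^{-Δ_i} ≤ 2^{-e₁}`
on the box, `2^{e₁} W ≤ p_box := ∑_{box} p_i ≤ 2^{e₂} W`, so a (lower, upper) pair gives
`2^{e₁} P̃_lo < p_box < 2^{e₂} P̃_hi`; in the standard normalisation (`g_{Δ,0} ∼ (z z̄)^{Δ/2}`; the tree's
`globalBlock Δ 0 = 2 k_Δ(z) k_Δ(z̄)`) `λ²_{σσ[box]} = 2 p_box`.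

This file TYPES the two statements (`OpeEpsUpperA2D`, `OpeEpsLowerA2D`, about `CrossingData.boxWeight`)
and PROVES:
* `box_tsum_lt_of_hasSum` / `lt_box_tsum_of_hasSum` — the abstract termwise steps (the in-box values
  `a_i = φ[F_i]` VARY over the box, so gen 12's constant-value lemma `indicator_tsum_bound_of_hasSum`
  does not apply; the argument compares `∑_{box} p_i a_i ≤ -a₁` with the cellwise inequality
  `P̃ · a_i / c_i > -a₁`, `c_i = 2^{-Δ_i}`, weighted by `p_i c_i ≥ 0`, and gets strictness from one
  non-zero term; summability of `W` is DERIVED — from bounded partial sums (upper) / from the uniform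
  sign margin (lower));
* `OpeEpsA2DObligations.opeEpsUpper` / `.opeEpsLower` — soundness for evaluation-continuous `φ` (the
  tree's typed termwise class), parallel to `OpeA2DObligations.opeUpper/opeLower`.
The assembly to `p_box` / `λ²`, the RB-6 rungs (Λ = 11, 15) and their decimal form are in
`Control2DOpeEpsRungs.lean`.

NOTHING numerical about a functional is asserted here: the certificates are external exact-arithmetic
objects checked by two independent readers. Sources: sum rule and linear-functional logic,
R. Rattazzi, V. S. Rychkov, E. Tonni, A. Vichi, JHEP 12 (2008) 031, §3–§5 (OPE-coefficient bounds
§5; two-sided bounds need the operator's dimension confined — F. Caracciolo, V. S. Rychkov,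
Phys. Rev. D 81 (2010) 085037, §4, is the float precedent; only the elementary sign argument is used
here). Tree: `CrossingData`, `IsUnitary`, `SatisfiesCrossing`, `BlockPositive` (`Control2DBootstrap.lean`),
`ScalarsIn`, `SpinTwoIn` (`Control2DIsland.lean`), `OpeA2DObligations.hasSum_apply`
(`Control2DOpeTwoSided.lean`), `EvaluationContinuous` (`Literature/…/ConformalBootstrap3D/DualFunctional.lean`).
-/

namespace Summit.CriticalPhenomena.Ising3D.Control2D

open Set
open Literature.MathematicalPhysics.QuantumFieldTheory.ConformalBootstrap3D

/-! ### The in-box scalar content and the two typed statements -/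

namespace CrossingData

/-- The set of indices of SCALAR quasi-primaries whose dimension lies in the `ε` box `[e₁, e₂]`.
[cite: RattazziEtAl2008, §5] -/
def boxSet (D : CrossingData) (e₁ e₂ : ℝ) : Set D.ι :=
  {i | D.spin i = 0 ∧ D.Δ i ∈ Icc e₁ e₂}

/-- The WEIGHTED in-box scalar content `W = ∑_{i ∈ box} p_i 2^{-Δ_i}` (an unconditional sum; `0` if
not summable — summability is derived from the certificates' obligations, see
`box_tsum_lt_of_hasSum` / `lt_box_tsum_of_hasSum`). The weight `2^{-Δ}` is the readers' unit
`S(Δ,ℓ) = 4^{Δ_σ} 2^Δ φ[F_{Δ,ℓ}]`, which keeps `2^Δ` out of every reader computation.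
[cite: RattazziEtAl2008, §3 eq. (3.6)] -/
noncomputable def boxWeight (D : CrossingData) (e₁ e₂ : ℝ) : ℝ :=
  ∑' i, (D.boxSet e₁ e₂).indicator (fun i => D.p i * (2 : ℝ) ^ (-D.Δ i)) i

/-- The TOTAL in-box scalar squared OPE coefficient `p_box = ∑_{i ∈ box} p_i` in the tree's block
normalisation `globalBlock Δ 0 = 2 k_Δ(z) k_Δ(z̄)` (an unconditional sum). For the 2D Ising CFT with
the box around `Δ_ε = 1` this is `p_ε = λ²_{σσε}/2 = 1/8`. [cite: RattazziEtAl2008, §3 eq. (3.6)] -/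
noncomputable def boxCoeff (D : CrossingData) (e₁ e₂ : ℝ) : ℝ :=
  ∑' i, (D.boxSet e₁ e₂).indicator D.p i

/-- The in-box content in the STANDARD normalisation `g_{Δ,0}(z,z̄) ∼ (z z̄)^{Δ/2}` of the squared OPE
coefficient: `λ²_{σσ[box]} = 2 p_box` (the tree's scalar block is `2 k_Δ(z) k_Δ(z̄)`, each
`k_Δ(x) ∼ x^{Δ/2}`). For 2D Ising `λ²_{σσε} = 1/4`. [cite: RattazziEtAl2008, §3 eq. (3.6)] -/
noncomputable def lambdaSqBox (D : CrossingData) (e₁ e₂ : ℝ) : ℝ :=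
  2 * D.boxCoeff e₁ e₂

end CrossingData

/-- **Kind-`ope2eps`, sense upper** (format `deriv-functional-2d/4`): in every parity-symmetric unitary
solution of the 2D `⟨σσσσ⟩` sum rule at `Δ_σ = s` with scalars in `[e₁, e₂] ∪ [G, ∞)` and spin-2
quasi-primaries in `{2} ∪ [2 + δ, ∞)`, the weighted in-box scalar content obeys `W < P`.
[cite: RattazziEtAl2008, §5] -/
def OpeEpsUpperA2D (s G δ e₁ e₂ P : ℝ) : Prop :=
  ∀ D : CrossingData, D.IsUnitary → D.SatisfiesCrossing s →
    D.ScalarsIn (Icc e₁ e₂ ∪ Ici G) → D.SpinTwoIn ({2} ∪ Ici (2 + δ)) → D.boxWeight e₁ e₂ < P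

/-- **Kind-`ope2eps`, sense lower**: under the same hypotheses `P < W` (in particular such a datum HAS
scalar content in the box when `P ≥ 0`). [cite: RattazziEtAl2008, §5] -/
def OpeEpsLowerA2D (s G δ e₁ e₂ P : ℝ) : Prop :=
  ∀ D : CrossingData, D.IsUnitary → D.SatisfiesCrossing s →
    D.ScalarsIn (Icc e₁ e₂ ∪ Ici G) → D.SpinTwoIn ({2} ∪ Ici (2 + δ)) → P < D.boxWeight e₁ e₂

/-! ### The abstract termwise steps -/

/-- The termwise comparison behind kind `ope2eps`: from `a₁ + P (a_i / c_i) > 0`, `c_i > 0`, `p_i ≥ 0`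
on the box one gets `(-a₁) · (p_i c_i) ≤ P · (p_i a_i)`, strictly if `p_i > 0`; off the box both
indicator terms vanish. Elementary. [folklore] -/
theorem box_term_le {ι : Type} (B : Set ι) {p a c : ι → ℝ} {a₁ P : ℝ} (hp : ∀ i, 0 ≤ p i)
    (hc : ∀ i, i ∈ B → 0 < c i) (hI : ∀ i, i ∈ B → 0 < a₁ + P * (a i / c i)) (i : ι) :
    (-a₁) * B.indicator (fun i => p i * c i) i ≤ P * B.indicator (fun i => p i * a i) i ∧
      (i ∈ B → 0 < p i →
        (-a₁) * B.indicator (fun i => p i * c i) i < P * B.indicator (fun i => p i * a i) i) := by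
  by_cases hi : i ∈ B
  · rw [Set.indicator_of_mem hi, Set.indicator_of_mem hi]
    have hci := hc i hi
    have hkey : P * (p i * a i) - (-a₁) * (p i * c i) = (p i * c i) * (a₁ + P * (a i / c i)) := by
      field_simp
      ring
    have hpc : 0 ≤ p i * c i := mul_nonneg (hp i) hci.le
    refine ⟨by nlinarith [mul_nonneg hpc (hI i hi).le], fun _ hpi => ?_⟩
    have hpc' : 0 < p i * c i := mul_pos hpi hci
    nlinarith [mul_pos hpc' (hI i hi)]
  · rw [Set.indicator_of_notMem hi, Set.indicator_of_notMem hi, mul_zero, mul_zero]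
    exact ⟨le_rfl, fun h _ => (hi h).elim⟩

/-- **The termwise step, sense upper.** For a summable identity `∑_i p_i a_i = -a₁` with `p ≥ 0`,
`a_i ≥ 0` off a set `B`, and on `B`: `a_i > 0`, `c_i > 0` and `a₁ + P (a_i/c_i) > 0`, with `P > 0`:
the weighted `B`-total `W = ∑_{i ∈ B} p_i c_i` is summable and `W < P`. (Here `a_i = φ[F_-[g_i]]`,
`a₁ = φ[F_-[𝟙]]`, `c_i = 2^{-Δ_i}`.) Proof: `∑_B p_i a_i ≤ -a₁ =: A`, all terms `≥ 0`; termwise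
`A p_i c_i ≤ P p_i a_i`, so every finite partial sum of `W` is `≤ P` when `A > 0` (and `W = 0` when
`A = 0`); strictness from one index with `p_i > 0`. Elementary real analysis. [folklore] -/
theorem box_tsum_lt_of_hasSum {ι : Type} (B : Set ι) {p a c : ι → ℝ} {a₁ P : ℝ}
    (hs : HasSum (fun i => p i * a i) (-a₁)) (hp : ∀ i, 0 ≤ p i)
    (hc : ∀ i, i ∈ B → 0 < c i) (hpos : ∀ i, i ∉ B → 0 ≤ a i)
    (hsign : ∀ i, i ∈ B → 0 < a i) (hI : ∀ i, i ∈ B → 0 < a₁ + P * (a i / c i)) (hP : 0 < P) :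
    Summable (B.indicator fun i => p i * c i) ∧ ∑' i, B.indicator (fun i => p i * c i) i < P := by
  set w : ι → ℝ := B.indicator fun i => p i * c i with hw_def
  set g : ι → ℝ := B.indicator fun i => p i * a i with hg_def
  have hfs : Summable (fun i => p i * a i) := hs.summable
  have hfnn : ∀ i, 0 ≤ p i * a i := by
    intro i
    by_cases hi : i ∈ B
    · exact mul_nonneg (hp i) (hsign i hi).le
    · exact mul_nonneg (hp i) (hpos i hi)
  have hA : 0 ≤ -a₁ := hs.nonneg hfnn
  have hgs : Summable g := hfs.indicator B
  have hgnn : ∀ i, 0 ≤ g i := fun i => Set.indicator_nonneg (fun j _ => hfnn j) i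
  have hwnn : ∀ i, 0 ≤ w i := fun i =>
    Set.indicator_nonneg (fun j hj => mul_nonneg (hp j) (hc j hj).le) i
  -- `∑ g ≤ ∑ p a = -a₁`
  have hgle : ∀ i, g i ≤ p i * a i := fun i =>
    Set.indicator_le_self' (fun j _ => hfnn j) i
  have hgsum : ∑' i, g i ≤ -a₁ := by
    have := Summable.tsum_le_tsum hgle hgs hfs
    rwa [hs.tsum_eq] at this
  have hterm := fun i => (box_term_le B hp hc hI i (a := a) (P := P)).1
  rcases hA.eq_or_lt with hA0 | hApos
  · -- `a₁ = 0`: every term vanishes, so `p_i = 0` on the box and `W = 0 < P`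
    have hzero : (fun i => p i * a i) = 0 := by
      have h0 : HasSum (fun i => p i * a i) 0 := by rw [hA0]; exact hs
      exact (hasSum_zero_iff_of_nonneg hfnn).mp h0
    have hw0 : w = 0 := by
      funext i
      by_cases hi : i ∈ B
      · have hpa : p i * a i = 0 := congrFun hzero i
        have hpi : p i = 0 := by
          rcases mul_eq_zero.mp hpa with h | h
          · exact h
          · exact ((hsign i hi).ne' h).elim
        simp [hw_def, Set.indicator_of_mem hi, hpi]
      · simp [hw_def, Set.indicator_of_notMem hi]
    refine ⟨by rw [hw0]; exact summable_zero, ?_⟩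
    rw [hw0]
    simpa using hP
  · -- `A = -a₁ > 0`: `w ≤ (P/A) g` termwise
    have hwle : ∀ i, w i ≤ (P / (-a₁)) * g i := by
      intro i
      have := hterm i
      rw [div_mul_eq_mul_div, le_div_iff₀ hApos]
      linarith
    have hws : Summable w :=
      Summable.of_nonneg_of_le hwnn hwle ((hgs.mul_left (P / (-a₁))))
    refine ⟨hws, ?_⟩
    -- `A W ≤ P ∑ g ≤ P A`, strictly if `W > 0`
    rcases (tsum_nonneg hwnn).eq_or_lt with hW0 | hWpos
    · rw [← hW0]; exact hP
    · -- some index carries weight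
      have hex : ∃ j, w j ≠ 0 := by
        by_contra hnone
        push Not at hnone
        have : ∑' i, w i = 0 := by
          rw [show w = fun _ => 0 from funext hnone]
          exact tsum_zero
        exact hWpos.ne' this
      obtain ⟨j, hj⟩ := hex
      have hjB : j ∈ B := by
        by_contra hjB
        exact hj (by simp [hw_def, Set.indicator_of_notMem hjB])
      have hpj : 0 < p j := by
        rcases (hp j).eq_or_lt with h0 | hlt
        · exact (hj (by simp [hw_def, Set.indicator_of_mem hjB, ← h0])).elim
        · exact hlt
      have hstrict := (box_term_le B hp hc hI j (a := a) (P := P)).2 hjB hpj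
      -- the family `P g - A w` is nonnegative, summable, positive at `j`
      have hds : Summable (fun i => P * g i - (-a₁) * w i) :=
        (hgs.mul_left P).sub (hws.mul_left (-a₁))
      have hsplit : ∑' i, (P * g i - (-a₁) * w i) = P * ∑' i, g i - (-a₁) * ∑' i, w i := by
        rw [Summable.tsum_sub (hgs.mul_left P) (hws.mul_left (-a₁)), tsum_mul_left, tsum_mul_left]
      have hdpos : 0 < P * ∑' i, g i - (-a₁) * ∑' i, w i := by
        rw [← hsplit]
        exact hds.tsum_pos (fun i => by linarith [hterm i]) j (by linarith)
      have h1 : (-a₁) * ∑' i, w i < P * (-a₁) := by nlinarith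
      rw [mul_comm P (-a₁)] at h1
      exact lt_of_mul_lt_mul_left h1 hApos.le

/-- **The termwise step, sense lower.** For a summable identity `∑_i p_i a_i = -a₁` with `p ≥ 0`,
`a_i ≥ 0` off `B`, and on `B`: `c_i > 0`, a UNIFORM sign margin `a_i / c_i ≤ -σ < 0` and
`a₁ + P (a_i/c_i) > 0`, with `a₁ > 0` and `P > 0`: the weighted `B`-total `W = ∑_{i ∈ B} p_i c_i` is
summable and `P < W`. Proof: `∑_B p_i a_i ≤ -a₁ < 0` forces a non-zero box term; `p_i c_i ≤ -(p_i a_i)/σ`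
gives summability; termwise `(-a₁) p_i c_i ≤ P p_i a_i` summed gives `(-a₁) W < P (-a₁)`.
Elementary real analysis. [folklore] -/
theorem lt_box_tsum_of_hasSum {ι : Type} (B : Set ι) {p a c : ι → ℝ} {a₁ P σ : ℝ}
    (hs : HasSum (fun i => p i * a i) (-a₁)) (hp : ∀ i, 0 ≤ p i)
    (hc : ∀ i, i ∈ B → 0 < c i) (hpos : ∀ i, i ∉ B → 0 ≤ a i) (hσ : 0 < σ)
    (hsign : ∀ i, i ∈ B → a i / c i ≤ -σ) (hI : ∀ i, i ∈ B → 0 < a₁ + P * (a i / c i))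
    (ha₁ : 0 < a₁) (hP : 0 < P) :
    Summable (B.indicator fun i => p i * c i) ∧ P < ∑' i, B.indicator (fun i => p i * c i) i := by
  set w : ι → ℝ := B.indicator fun i => p i * c i with hw_def
  set g : ι → ℝ := B.indicator fun i => p i * a i with hg_def
  have hfs : Summable (fun i => p i * a i) := hs.summable
  have hgs : Summable g := hfs.indicator B
  have hwnn : ∀ i, 0 ≤ w i := fun i =>
    Set.indicator_nonneg (fun j hj => mul_nonneg (hp j) (hc j hj).le) i
  -- `g ≤ p a` termwise (off the box `p a ≥ 0`), hence `∑ g ≤ -a₁ < 0`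
  have hgle : ∀ i, g i ≤ p i * a i := by
    intro i
    by_cases hi : i ∈ B
    · rw [hg_def, Set.indicator_of_mem hi]
    · rw [hg_def, Set.indicator_of_notMem hi]; exact mul_nonneg (hp i) (hpos i hi)
  have hgsum : ∑' i, g i ≤ -a₁ := by
    have := Summable.tsum_le_tsum hgle hgs hfs
    rwa [hs.tsum_eq] at this
  -- summability of `w` from the margin: `w ≤ (-g)/σ`
  have hwle : ∀ i, w i ≤ σ⁻¹ * (-g i) := by
    intro i
    by_cases hi : i ∈ B
    · rw [hw_def, hg_def, Set.indicator_of_mem hi, Set.indicator_of_mem hi]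
      have hci := hc i hi
      have h1 : a i ≤ -σ * c i := by
        have := hsign i hi
        rwa [div_le_iff₀ hci] at this
      rw [le_inv_mul_iff₀ hσ]
      nlinarith [hp i]
    · rw [hw_def, hg_def, Set.indicator_of_notMem hi, Set.indicator_of_notMem hi]
      simp
  have hws : Summable w := Summable.of_nonneg_of_le hwnn hwle (hgs.neg.mul_left σ⁻¹)
  refine ⟨hws, ?_⟩
  have hterm := fun i => (box_term_le B hp hc hI i (a := a) (P := P)).1
  -- a non-zero box term exists since `∑ g ≤ -a₁ < 0`
  have hex : ∃ j, g j ≠ 0 := by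
    by_contra hnone
    push Not at hnone
    have : ∑' i, g i = 0 := by
      rw [show g = fun _ => 0 from funext hnone]
      exact tsum_zero
    linarith
  obtain ⟨j, hj⟩ := hex
  have hjB : j ∈ B := by
    by_contra hjB
    exact hj (by simp [hg_def, Set.indicator_of_notMem hjB])
  have hpj : 0 < p j := by
    rcases (hp j).eq_or_lt with h0 | hlt
    · exact (hj (by simp [hg_def, Set.indicator_of_mem hjB, ← h0])).elim
    · exact hlt
  have hstrict := (box_term_le B hp hc hI j (a := a) (P := P)).2 hjB hpj
  have hds : Summable (fun i => P * g i - (-a₁) * w i) :=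
    (hgs.mul_left P).sub (hws.mul_left (-a₁))
  have hsplit : ∑' i, (P * g i - (-a₁) * w i) = P * ∑' i, g i - (-a₁) * ∑' i, w i := by
    rw [Summable.tsum_sub (hgs.mul_left P) (hws.mul_left (-a₁)), tsum_mul_left, tsum_mul_left]
  have hdpos : 0 < P * ∑' i, g i - (-a₁) * ∑' i, w i := by
    rw [← hsplit]
    exact hds.tsum_pos (fun i => by linarith [hterm i]) j (by linarith)
  -- `(-a₁) W < P ∑ g ≤ P (-a₁)`, and `-a₁ < 0`
  have h1 : (-a₁) * ∑' i, w i < (-a₁) * P := by nlinarith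
  exact lt_of_mul_lt_mul_of_nonpos_left h1 (by linarith)

/-! ### Obligations of a functional and soundness for the typed termwise class -/

/-- **The obligations of a kind-`ope2eps` certificate** for a functional `φ` at external dimension `s`
under `A2D′` with the `ε` box `[e₁, e₂]`, scalar gap `G`, spin-2 gap `δ`, bound `P` and threshold `E₀`:
(I″) on every `ε` cell `φ[F_-[𝟙]] + P · 2^Δ φ[F_-[g_{Δ,0}]] > 0`, and block positivity on the scalars in
`[G, E₀)`, at the stress-tensor point `(2,2)`, on spin 2 in `[2 + δ, E₀)`, on even spins `ℓ ≥ 4` with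
`ℓ ≤ Δ < E₀`, and on everything at or above `E₀` (the readers' region step). The SIGN of
`φ[F_-[g_{Δ,0}]]` on the box is supplied separately to `opeEpsUpper` / `opeEpsLower`.
[cite: RattazziEtAl2008, §5.5] -/
structure OpeEpsA2DObligations (φ : (ℝ → ℝ → ℝ) →ₗ[ℝ] ℝ) (s G δ e₁ e₂ P E₀ : ℝ) : Prop where
  /-- (I″) `φ[F_-[𝟙]] + P · 2^Δ φ[F_-[g_{Δ,0}]] > 0` on every `ε` cell. -/
  identity_ope : ∀ Δ : ℝ, e₁ ≤ Δ → Δ ≤ e₂ →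
    0 < φ (crossF s (-1) (fun _ _ => (1 : ℝ))) + P * ((2 : ℝ) ^ Δ * φ (crossF s (-1) (globalBlock Δ 0)))
  /-- (S) scalars between the gap `G` and the threshold. -/
  scalar_nonneg : ∀ Δ : ℝ, G ≤ Δ → Δ < E₀ → BlockPositive φ s Δ 0
  /-- The stress-tensor point `(Δ, ℓ) = (2, 2)` (a positivity row for this kind). -/
  stress_nonneg : BlockPositive φ s 2 2
  /-- Spin 2 above the spin-2 gap, below the threshold. -/
  spinTwo_nonneg : ∀ Δ : ℝ, 2 + δ ≤ Δ → Δ < E₀ → BlockPositive φ s Δ 2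
  /-- Even spins `ℓ ≥ 4` below the threshold (unitarity `Δ ≥ ℓ` only). -/
  spinning_nonneg : ∀ ℓ : ℕ, Even ℓ → ℓ ≠ 0 → ℓ ≠ 2 → ∀ Δ : ℝ, (ℓ : ℝ) ≤ Δ → Δ < E₀ →
    BlockPositive φ s Δ ℓ
  /-- Everything at or above the threshold (all even spins). -/
  high_nonneg : ∀ ℓ : ℕ, Even ℓ → ∀ Δ : ℝ, (ℓ : ℝ) ≤ Δ → E₀ ≤ Δ → BlockPositive φ s Δ ℓ

namespace OpeEpsA2DObligations

variable {φ : (ℝ → ℝ → ℝ) →ₗ[ℝ] ℝ} {s G δ e₁ e₂ P E₀ : ℝ}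

/-- Every block of an `A2D′` datum other than the in-box scalars is covered by a positivity clause.
Elementary case analysis. [folklore] -/
theorem blockPositive_off_box (h : OpeEpsA2DObligations φ s G δ e₁ e₂ P E₀) {D : CrossingData}
    (hU : D.IsUnitary) (hS : D.ScalarsIn (Icc e₁ e₂ ∪ Ici G)) (hT2 : D.SpinTwoIn ({2} ∪ Ici (2 + δ)))
    (i : D.ι) (hi : i ∉ D.boxSet e₁ e₂) : BlockPositive φ s (D.Δ i) (D.spin i) := by
  obtain ⟨hev, hΔℓ, -⟩ := hU i
  rcases le_or_gt E₀ (D.Δ i) with hge | hlt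
  · exact h.high_nonneg _ hev _ hΔℓ hge
  by_cases h0 : D.spin i = 0
  · rcases hS i h0 with hbox | hG
    · exact (hi ⟨h0, hbox⟩).elim
    · rw [h0]
      exact h.scalar_nonneg _ hG hlt
  by_cases h2 : D.spin i = 2
  · rw [h2]
    rcases hT2 i h2 with hpt | hgap
    · rw [Set.mem_singleton_iff.mp hpt]
      exact h.stress_nonneg
    · exact h.spinTwo_nonneg _ hgap hlt
  · exact h.spinning_nonneg _ hev h0 h2 _ hΔℓ hlt

/-- The weight `c_i = 2^{-Δ_i}` is positive and `a / 2^{-Δ} = 2^Δ a`. Elementary. [folklore] -/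
theorem div_two_rpow_neg (Δ a : ℝ) : a / (2 : ℝ) ^ (-Δ) = (2 : ℝ) ^ Δ * a := by
  rw [Real.rpow_neg (by norm_num : (0 : ℝ) ≤ 2), div_inv_eq_mul, mul_comm]

/-- **Soundness of kind `ope2eps`, sense upper**: the obligations plus `φ[F_-[g_{Δ,0}]] > 0` on the box
and `P > 0` give `OpeEpsUpperA2D`. PROVED (termwise argument `box_tsum_lt_of_hasSum`).
[cite: RattazziEtAl2008, §5] -/
theorem opeEpsUpper (hφ : EvaluationContinuous φ) (h : OpeEpsA2DObligations φ s G δ e₁ e₂ P E₀)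
    (hP : 0 < P) (hX : ∀ Δ : ℝ, e₁ ≤ Δ → Δ ≤ e₂ → 0 < φ (crossF s (-1) (globalBlock Δ 0))) :
    OpeEpsUpperA2D s G δ e₁ e₂ P := by
  intro D hU hC hS hT2
  unfold CrossingData.boxWeight
  refine (box_tsum_lt_of_hasSum (D.boxSet e₁ e₂) (c := fun i => (2 : ℝ) ^ (-D.Δ i))
    (OpeA2DObligations.hasSum_apply hφ hC) (fun i => (hU i).2.2)
    (fun i _ => Real.rpow_pos_of_pos (by norm_num) _)
    (fun i hi => h.blockPositive_off_box hU hS hT2 i hi) (fun i hi => ?_) (fun i hi => ?_) hP).2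
  · obtain ⟨h0, hΔ⟩ := hi
    have := hX (D.Δ i) hΔ.1 hΔ.2
    rwa [h0]
  · obtain ⟨h0, hΔ⟩ := hi
    have := h.identity_ope (D.Δ i) hΔ.1 hΔ.2
    rwa [h0, div_two_rpow_neg]

/-- **Soundness of kind `ope2eps`, sense lower**: the obligations plus a uniform negative sign margin
`2^Δ φ[F_-[g_{Δ,0}]] ≤ -σ < 0` on the box (what a cellwise certificate of `< 0` on the compact box
establishes), a non-empty box and `P > 0` give `OpeEpsLowerA2D`. PROVED (termwise argument
`lt_box_tsum_of_hasSum`; `φ[F_-[𝟙]] > 0` follows from (I″) at `Δ = e₁`). [cite: RattazziEtAl2008, §5] -/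
theorem opeEpsLower (hφ : EvaluationContinuous φ) (h : OpeEpsA2DObligations φ s G δ e₁ e₂ P E₀)
    (hP : 0 < P) (he : e₁ ≤ e₂) {σ : ℝ} (hσ : 0 < σ)
    (hX : ∀ Δ : ℝ, e₁ ≤ Δ → Δ ≤ e₂ → (2 : ℝ) ^ Δ * φ (crossF s (-1) (globalBlock Δ 0)) ≤ -σ) :
    OpeEpsLowerA2D s G δ e₁ e₂ P := by
  intro D hU hC hS hT2
  unfold CrossingData.boxWeight
  have ha₁ : 0 < φ (crossF s (-1) (fun _ _ => (1 : ℝ))) := by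
    have h1 := h.identity_ope e₁ le_rfl he
    have h2 := hX e₁ le_rfl he
    nlinarith
  refine (lt_box_tsum_of_hasSum (D.boxSet e₁ e₂) (c := fun i => (2 : ℝ) ^ (-D.Δ i))
    (OpeA2DObligations.hasSum_apply hφ hC) (fun i => (hU i).2.2)
    (fun i _ => Real.rpow_pos_of_pos (by norm_num) _)
    (fun i hi => h.blockPositive_off_box hU hS hT2 i hi) hσ (fun i hi => ?_) (fun i hi => ?_)
    ha₁ hP).2
  · obtain ⟨h0, hΔ⟩ := hi
    have := hX (D.Δ i) hΔ.1 hΔ.2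
    rwa [h0, div_two_rpow_neg]
  · obtain ⟨h0, hΔ⟩ := hi
    have := h.identity_ope (D.Δ i) hΔ.1 hΔ.2
    rwa [h0, div_two_rpow_neg]

end OpeEpsA2DObligations

end Summit.CriticalPhenomena.Ising3D.Control2D
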